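import Mathlib
import HarnessLib
import Literature.Computability.AlgebraicComplexity.SupportRank
import Literature.Computability.AlgebraicComplexity.SupportRankProofs
import Literature.Computability.AlgebraicComplexity.SupportRankWeightRemoval
import Summits.MatrixMultiplication.MatrixMultiplication.Theses.CommutativeSchemes

/-!
# `WeightRemoval` (stmt-MatrixMultiplication-9463) — CU13 Prop. 5 + Thm. 6 in finite form

Route `MatrixMultiplication/CommutativeSchemes`, item `stmt-MatrixMultiplication-9463` (crux, rank 2):

  `WeightRemoval : ∀ ε > 0, ∀ n ≥ 2, (∃ t with supp t = supp ⟨n,n,n⟩ over ℂ and R(t) ≤ n^(2+ε)) →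
     ω(ℂ) ≤ 2 + (3/2)·ε`.

This file is the crux line `registered` (= `Cruxes/WeightRemoval/Lines/birth.lean`, the BC3 birth
skeleton) with its two stubs closed.  The line is the route header's own proof-in-print
(Cohn–Umans 2013 = arXiv:1207.6528, §3), cut at its two published theorems, each stated over the
tree's s-rank vocabulary (`Literature/Computability/AlgebraicComplexity/SupportRank.lean`:
`supportRank = R_s`, `omegaS K = ω_s(K) = inf {τ : R_s(⟨n,n,n⟩) = O(n^τ)}`):

* `WeightRemovalLine.stub_sRankExponent` — CU13 PROPOSITION 5, `(l·m·n)^(ω_s/3) ≤ R_s(⟨l,m,n⟩)`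
  for all `l, m, n` (s-rank is submultiplicative under Kronecker products and
  `supp(⟨n,n,n⟩^{⊗k}) = supp ⟨n^k,n^k,n^k⟩`; symmetrise over the three rotations, `k → ∞`).
  It is the named fact `CohnUmans2013_prop_5`, DISCHARGED in the tree by
  `Literature.Computability.AlgebraicComplexity.CohnUmans2013_prop_5_holds`
  (`SupportRankProofs.lean`), which closes the stub by `exact`.
* `WeightRemovalLine.stub_weightRemovalExponent` — CU13 THEOREM 6, `ω ≤ (3ω_s − 2)/2` (a
  triangle-free `S ⊆ Δ_N` with `|S| = N^(2−o(1))` makes `|S| ⊙ ⟨N²,N²,N²⟩` a restriction of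
  `T^{⊗3}` for any `T` with the support of `⟨N,N,N⟩`; then the asymptotic sum inequality).  It is
  the named fact `CohnUmans2013_thm_6`, DISCHARGED in the tree by
  `Literature.Computability.AlgebraicComplexity.CohnUmans2013_thm_6_holds`
  (`SupportRankWeightRemoval.lean`: the cube substitution
  `tensorRank_multiple_matMulTensor_le_cube`, Behrend triangle-free families
  `exists_triangleFree`, `two_add_two_mul_omega_le`), which closes the stub by `exact`.
* `WeightRemovalLine.WeightRemoval_of : <stub₁-sig> → <stub₂-sig> → WeightRemoval` — the
  composition, which is exactly the finite-form bookkeeping the item's informal text describes: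
  from the witness `t`, `R_s(⟨n,n,n⟩) ≤ R(t) ≤ n^(2+ε)`; Prop. 5 at `(n,n,n)` reads
  `(n³)^(ω_s/3) = n^(ω_s) ≤ R_s(⟨n,n,n⟩)`, so `n^(ω_s) ≤ n^(2+ε)` and (`n ≥ 2 > 1`) `ω_s ≤ 2 + ε`;
  Thm. 6 then gives `ω ≤ (3(2+ε) − 2)/2 = 2 + (3/2)ε`.
* `weightRemoval_proof : …Theses.CommutativeSchemes.WeightRemoval` — the crux BY NAME, the
  file's closing theorem (type literally the route decl).

Everything is sorry-free with standard axioms.  Consequence for the route: with `RealizationSRank`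
(item 9466) and the assembly (item 9470) already proved, the only open binder of the deciding
theorem `closes : CommutativeRealization → RealizationSRank → WeightRemoval → MatrixMultiplication`
is the target `CommutativeRealization` (CU13 Conj. 21) itself.

References: H. Cohn, C. Umans, *Fast matrix multiplication using coherent configurations*,
SODA 2013 (arXiv:1207.6528), §3, Prop. 5 and Thm. 6; H. Cohn, R. Kleinberg, B. Szegedy, C. Umans,
*Group-theoretic algorithms for matrix multiplication*, FOCS 2005, §6.2; M. Bläser, *Fast Matrix
Multiplication*, Theory of Computing Graduate Surveys 5 (2013), §5–7 (the tree's
`tensorRank`/`omega` conventions).  Not here: any new definition; the two CU13 theorems themselves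
(imported from `Literature`, not restated).
-/

-- single-conjunct summit: the mandated namespace `Summit.MatrixMultiplication.MatrixMultiplication.…`
-- repeats `MatrixMultiplication` (summit = sub-problem), which `linter.dupNamespace` would flag.
set_option linter.dupNamespace false

namespace Summit.MatrixMultiplication.MatrixMultiplication.Theorems

open Literature.Computability.AlgebraicComplexity
open Summit.MatrixMultiplication.MatrixMultiplication.Theses.CommutativeSchemes

namespace WeightRemovalLine

/-! ## The two registered stubs of line `registered` (birth), closed by the tree's discharges -/

/-- **Stub 1 — Cohn–Umans 2013, Proposition 5 (the s-rank exponent is a per-format lower bound):**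
for all `l m n`, `(l·m·n)^(ω_s(ℂ)/3) ≤ R_s(⟨l,m,n⟩)`.  This is verbatim the named fact
`CohnUmans2013_prop_5` of `SupportRank.lean` (s-rank is submultiplicative,
`R_s(s ⊗ t) ≤ R_s(s) R_s(t)`, and Kronecker powers of `⟨l,m,n⟩` have the support of `⟨lᵏ,mᵏ,nᵏ⟩`;
symmetrise over the three rotations and take `k → ∞` in the definition of `ω_s`), closed here by
its tree discharge `CohnUmans2013_prop_5_holds` (`SupportRankProofs.lean`).  Role in the line: turns
the finite witness `R_s(⟨n,n,n⟩) ≤ n^(2+ε)` into the exponent bound `ω_s ≤ 2 + ε`.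
[cite: CohnUmans2013, Prop. 5] -/
theorem stub_sRankExponent :
    ∀ l m n : ℕ, ((l * m * n : ℕ) : ℝ) ^ (Literature.Computability.AlgebraicComplexity.omegaS ℂ / 3) ≤
      (Literature.Computability.AlgebraicComplexity.supportRank
        (Literature.Computability.AlgebraicComplexity.matMulTensor ℂ l m n) : ℝ) :=
  CohnUmans2013_prop_5_holds

/-- **Stub 2 — Cohn–Umans 2013, Theorem 6 (weight removal): `ω(ℂ) ≤ (3 ω_s(ℂ) − 2) / 2`.**
This is verbatim the named fact `CohnUmans2013_thm_6` of `SupportRank.lean` (for `T` with the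
support of `⟨N,N,N⟩` and a triangle-free `S ⊆ Δ_N` of size `N^(2−o(1))` (Salem–Spencer/Behrend,
CKSU05 §6.2), the direct sum `|S| ⊙ ⟨N²,N²,N²⟩` is a restriction of `T ⊗ T ⊗ T` after rescaling
variables by the inverse weights, so `|S| (N²)^ω ≤ R(T)³` by the asymptotic sum inequality, i.e.
`2 + 2ω ≤ 3ω_s`), closed here by its tree discharge `CohnUmans2013_thm_6_holds`
(`SupportRankWeightRemoval.lean`).  The load-bearing stub of the line.
[cite: CohnUmans2013, Thm. 6] -/
theorem stub_weightRemovalExponent :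
    Literature.Computability.AlgebraicComplexity.omega ℂ ≤
      (3 * Literature.Computability.AlgebraicComplexity.omegaS ℂ - 2) / 2 :=
  CohnUmans2013_thm_6_holds

/-! ## The composition: the two stubs prove the crux -/

/-- **THE SKELETON THEOREM** (BC3 shape `stub₁-sig → stub₂-sig → crux`): CU13 Prop. 5 and Thm. 6
imply the route item `WeightRemoval` (stmt-MatrixMultiplication-9463).  The finite-form bookkeeping:
`R_s(⟨n,n,n⟩) ≤ R(t) ≤ n^(2+ε)` for the witness `t` (same support); Prop. 5 at `(n,n,n)` is
`(n³)^(ω_s/3) = n^(ω_s) ≤ R_s(⟨n,n,n⟩)`; since `n ≥ 2 > 1`, `ω_s ≤ 2 + ε`; Thm. 6 gives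
`ω ≤ (3(2+ε) − 2)/2 = 2 + (3/2)ε`.  (The hypothesis `0 < ε` of the item is not needed.)
[cite: CohnUmans2013, Prop. 5, Thm. 6] -/
theorem WeightRemoval_of :
    (∀ l m n : ℕ, ((l * m * n : ℕ) : ℝ) ^ (Literature.Computability.AlgebraicComplexity.omegaS ℂ / 3) ≤
      (Literature.Computability.AlgebraicComplexity.supportRank
        (Literature.Computability.AlgebraicComplexity.matMulTensor ℂ l m n) : ℝ)) →
    (Literature.Computability.AlgebraicComplexity.omega ℂ ≤
      (3 * Literature.Computability.AlgebraicComplexity.omegaS ℂ - 2) / 2) →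
    Summit.MatrixMultiplication.MatrixMultiplication.Theses.CommutativeSchemes.WeightRemoval := by
  intro h5 h6 ε _hε n hn hex
  obtain ⟨t, ht, htr⟩ := hex
  have hn0 : (0 : ℝ) < n := by exact_mod_cast (by omega : 0 < n)
  have hn1 : (1 : ℝ) < n := by exact_mod_cast (by omega : 1 < n)
  -- the witness has the support of `⟨n,n,n⟩` (the item states the iff in the other direction)
  have hst : SameSupport (matMulTensor ℂ n n n) t := fun i j k => (ht i j k).symm
  -- `R_s(⟨n,n,n⟩) ≤ R(t) ≤ n^(2+ε)`
  have hs : (supportRank (matMulTensor ℂ n n n) : ℝ) ≤ (n : ℝ) ^ (2 + ε) := by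
    have h1 : supportRank (matMulTensor ℂ n n n) ≤ tensorRank t :=
      supportRank_le_of_sameSupport hst le_rfl
    exact le_trans (by exact_mod_cast h1) htr
  -- Prop. 5 at `(n,n,n)`: `(n³)^(ω_s/3) = n^(ω_s) ≤ R_s(⟨n,n,n⟩)`
  have hp := h5 n n n
  have hpow : ((n * n * n : ℕ) : ℝ) ^ (omegaS ℂ / 3) = (n : ℝ) ^ omegaS ℂ := by
    have h3 : ((n * n * n : ℕ) : ℝ) = (n : ℝ) ^ (3 : ℝ) := by
      push_cast
      rw [show (3 : ℝ) = ((3 : ℕ) : ℝ) by norm_num, Real.rpow_natCast]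
      ring
    rw [h3, ← Real.rpow_mul hn0.le]
    congr 1
    ring
  rw [hpow] at hp
  -- `n^(ω_s) ≤ n^(2+ε)` with `n > 1`, so `ω_s ≤ 2 + ε`
  have hle : (n : ℝ) ^ omegaS ℂ ≤ (n : ℝ) ^ (2 + ε) := hp.trans hs
  have hωs : omegaS ℂ ≤ 2 + ε := (Real.rpow_le_rpow_left_iff hn1).1 hle
  -- Thm. 6: `ω ≤ (3ω_s − 2)/2 ≤ (3(2+ε) − 2)/2 = 2 + (3/2)ε`
  calc omega ℂ ≤ (3 * omegaS ℂ - 2) / 2 := h6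
    _ ≤ (3 * (2 + ε) - 2) / 2 := by gcongr
    _ = 2 + 3 / 2 * ε := by ring

end WeightRemovalLine

/-- **Weight removal in finite form** (settles `stmt-MatrixMultiplication-9463`; exact route signature
`Summit.MatrixMultiplication.MatrixMultiplication.Theses.CommutativeSchemes.WeightRemoval`): if for
some `n ≥ 2` a tensor over `ℂ` with exactly the support of `⟨n,n,n⟩` has rank `≤ n^(2+ε)`, then
`ω(ℂ) ≤ 2 + (3/2)ε`.  Obtained from the line's composition `WeightRemovalLine.WeightRemoval_of` fed
with the two closed stubs, i.e. with the tree's discharges of Cohn–Umans 2013 Prop. 5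
(`CohnUmans2013_prop_5_holds`) and Thm. 6 (`CohnUmans2013_thm_6_holds`).
[cite: CohnUmans2013, Prop. 5, Thm. 6] -/
theorem weightRemoval_proof :
    Summit.MatrixMultiplication.MatrixMultiplication.Theses.CommutativeSchemes.WeightRemoval :=
  WeightRemovalLine.WeightRemoval_of WeightRemovalLine.stub_sRankExponent
    WeightRemovalLine.stub_weightRemovalExponent

end Summit.MatrixMultiplication.MatrixMultiplication.Theorems
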